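import Literature.NumberTheory.Sieve.QuadraticRootsAllModuliKloosterman
import HarnessLib

/-!
# The divisor sum `∑_{c ≡ 0 (q)} τ(c) (h,c)^{1/2} c^{-1/2}` behind DFI's `(h,q)^{1/2} q⁻¹ τ(hq)` (DFI 1995, Prop. 4, support file)

Topic `Literature/NumberTheory/Sieve`.  Arithmetic support file of the elementary proof of
Proposition 4 of W. Duke, J. B. Friedlander, H. Iwaniec, *Equidistribution of roots of a quadratic
congruence to prime moduli*, Ann. of Math. 141 (1995).  After unfolding, the `L²`-norm of the
Poincaré series (14) on `Γ₀(q)∖ℍ` is a diagonal term plus `∑_{c ≡ 0 (q)} S(h,h;c) I_c` with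
Kloosterman sums `S(h,h;c)` and `|I_c| ≪ 1/(cY)`, `I_c = 0` for `c > 1/Y`; Weil's bound
`|S(h,h;c)| ≤ τ(c) (h,c)^{1/2} c^{1/2}` then leaves the sum bounded here:

* `sum_tau_sqrt_gcd_div_sqrt_le` — for `h, q ≥ 1` and `X ≥ 1`,
  `∑_{c ≤ X, q ∣ c} τ(c) (h,c)^{1/2} c^{-1/2} ≤ 128 (h,q)^{1/2} τ(hq) q⁻¹ X^{1/2} (1 + log X)`,
  which is the arithmetic factor `(h,q)^{1/2} q⁻¹ τ(hq)` of DFI's (23) and Proposition 3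
  [cite: DukeFriedlanderIwaniec1995, (23) p. 431].

The proof: `(h, qs) = (h,q)·(h₁, s)` with `h₁ = h/(h,q)` (`gcd_mul_eq`); grouping `s` by
`e = (h₁, s) ∣ h₁` and `τ(qet) ≤ τ(qe) τ(t)`, the tree's `∑_{t ≤ T} τ(t)/√t ≤ 2√T (1 + log T)`
(`Hooley1963.sum_card_divisors_div_sqrt_le`) reduces everything to the divisor sum
`∑_{e ∣ h₁} τ(qe)/√e ≤ 64 τ(hq)` (`sum_divisors_tau_mul_div_sqrt_le`), proved prime by prime
(`Nat.recOnPrimePow`): peeling `p^n ∥ h₁`, `p^α ∥ q` multiplies the sum by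
`∑_{j ≤ n} (α + j + 1) p^{-j/2}`, which is at most `2α + n + 1` for `p ≥ 5` and at most
`8 (2α + n + 1)` for `p = 2, 3` (`sum_range_linear_mul_pow_le`), while `τ(hq)` gains the factor
`2α + n + 1` exactly (for `p ∣ h₁` one has `v_p(h,q) = v_p(q)`).  Everything here is proved; no
statement of the paper is vendored (no new named fact, no definition).

## References

* W. Duke, J. B. Friedlander, H. Iwaniec, Ann. of Math. (2) 141 (1995), 423–441, (23) and
  Proposition 3, p. 431. [cite: DukeFriedlanderIwaniec1995, (23) p. 431]
-/

noncomputable section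

namespace Literature.NumberTheory.Sieve

open Finset Real

namespace DFI1995

/-! ### The per-prime factor `∑_{j ≤ n} (α + j + 1) r^j` -/

/-- `∑_{j ≤ n} (α + 1 + j) r^j ≤ (α + 1)/(1 - r) + r/(1 - r)²` for `0 ≤ r < 1` (compare with the
full series `∑ r^j = 1/(1-r)`, `∑ j r^j = r/(1-r)²`). [folklore] -/
theorem sum_range_linear_mul_pow_le_series {r : ℝ} (hr0 : 0 ≤ r) (hr1 : r < 1) (α n : ℕ) :
    ∑ j ∈ range (n + 1), ((α : ℝ) + j + 1) * r ^ j ≤ (α + 1) / (1 - r) + r / (1 - r) ^ 2 := by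
  have hnorm : ‖r‖ < 1 := by rw [Real.norm_eq_abs, abs_of_nonneg hr0]; exact hr1
  have hs1 : Summable fun j : ℕ => r ^ j := summable_geometric_of_lt_one hr0 hr1
  have hs2 : Summable fun j : ℕ => (j : ℝ) * r ^ j := by
    simpa using summable_pow_mul_geometric_of_norm_lt_one 1 hnorm
  have h1 : ∑ j ∈ range (n + 1), r ^ j ≤ 1 / (1 - r) := by
    rw [one_div, ← tsum_geometric_of_lt_one hr0 hr1]
    exact hs1.sum_le_tsum _ fun j _ => pow_nonneg hr0 j
  have h2 : ∑ j ∈ range (n + 1), (j : ℝ) * r ^ j ≤ r / (1 - r) ^ 2 := by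
    rw [← tsum_coe_mul_geometric_of_norm_lt_one hnorm]
    exact hs2.sum_le_tsum _ fun j _ => mul_nonneg (Nat.cast_nonneg j) (pow_nonneg hr0 j)
  have e : ∑ j ∈ range (n + 1), ((α : ℝ) + j + 1) * r ^ j =
      (α + 1) * ∑ j ∈ range (n + 1), r ^ j + ∑ j ∈ range (n + 1), (j : ℝ) * r ^ j := by
    rw [mul_sum, ← sum_add_distrib]
    refine sum_congr rfl fun j _ => ?_
    ring
  rw [e]
  have hα : (0 : ℝ) ≤ α + 1 := by positivity
  calc (α + 1 : ℝ) * ∑ j ∈ range (n + 1), r ^ j + ∑ j ∈ range (n + 1), (j : ℝ) * r ^ j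
      ≤ (α + 1) * (1 / (1 - r)) + r / (1 - r) ^ 2 := add_le_add (mul_le_mul_of_nonneg_left h1 hα) h2
    _ = (α + 1) / (1 - r) + r / (1 - r) ^ 2 := by ring

/-- **The per-prime inequality for `p ≥ 5`** (`r = p^{-1/2} ≤ 1/2`): for `n ≥ 1`,
`∑_{j ≤ n} (α + j + 1) r^j ≤ 2α + n + 1`. [folklore] -/
theorem sum_range_linear_mul_pow_le_of_le_half {r : ℝ} (hr0 : 0 ≤ r) (hr : r ≤ 1 / 2) (α : ℕ)
    {n : ℕ} (hn : 1 ≤ n) :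
    ∑ j ∈ range (n + 1), ((α : ℝ) + j + 1) * r ^ j ≤ 2 * α + n + 1 := by
  have hα : (0 : ℝ) ≤ α := Nat.cast_nonneg α
  rcases Nat.lt_or_ge n 3 with hn3 | hn3
  · interval_cases n
    · -- `n = 1`
      simp only [sum_range_succ, sum_range_zero, zero_add, Nat.cast_zero, add_zero, pow_zero,
        mul_one, Nat.cast_one, pow_one]
      nlinarith
    · -- `n = 2`
      simp only [sum_range_succ, sum_range_zero, zero_add, Nat.cast_zero, add_zero, pow_zero,
        mul_one, Nat.cast_one, pow_one, Nat.cast_ofNat]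
      have hr2 : r ^ 2 ≤ 1 / 4 := by nlinarith
      nlinarith
  · -- `n ≥ 3`: the series bound `≤ 2(α + 1) + 2`
    have h := sum_range_linear_mul_pow_le_series hr0 (by linarith) α n
    have h1 : (α + 1 : ℝ) / (1 - r) ≤ 2 * (α + 1) := by
      rw [div_le_iff₀ (by linarith)]; nlinarith
    have h2 : r / (1 - r) ^ 2 ≤ 2 := by
      rw [div_le_iff₀ (by nlinarith)]; nlinarith
    have h3 : (3 : ℝ) ≤ n := by exact_mod_cast hn3
    linarith

/-- **The per-prime inequality for every prime** (`r = p^{-1/2} ≤ 3/4`): for `n ≥ 1`,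
`∑_{j ≤ n} (α + j + 1) r^j ≤ 8 (2α + n + 1)`. [folklore] -/
theorem sum_range_linear_mul_pow_le_of_le_three_quarters {r : ℝ} (hr0 : 0 ≤ r) (hr : r ≤ 3 / 4)
    (α : ℕ) {n : ℕ} (hn : 1 ≤ n) :
    ∑ j ∈ range (n + 1), ((α : ℝ) + j + 1) * r ^ j ≤ 8 * (2 * α + n + 1) := by
  have hα : (0 : ℝ) ≤ α := Nat.cast_nonneg α
  have h := sum_range_linear_mul_pow_le_series hr0 (by linarith) α n
  have h1 : (α + 1 : ℝ) / (1 - r) ≤ 4 * (α + 1) := by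
    rw [div_le_iff₀ (by linarith)]; nlinarith
  have h2 : r / (1 - r) ^ 2 ≤ 12 := by
    rw [div_le_iff₀ (by nlinarith)]; nlinarith
  have h3 : (1 : ℝ) ≤ n := by exact_mod_cast hn
  linarith

/-- `1/√p ≤ 3/4` for `p ≥ 2` and `1/√p ≤ 1/2` for `p ≥ 5`. [folklore] -/
theorem inv_sqrt_le_of_prime {p : ℕ} (hp : p.Prime) :
    (Real.sqrt p)⁻¹ ≤ 3 / 4 ∧ (5 ≤ p → (Real.sqrt p)⁻¹ ≤ 1 / 2) := by
  have hp2 : (2 : ℝ) ≤ p := by exact_mod_cast hp.two_le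
  have hsq : (4 / 3 : ℝ) ≤ Real.sqrt p := by
    rw [Real.le_sqrt (by norm_num) (by linarith)]; nlinarith
  constructor
  · rw [inv_le_comm₀ (by linarith) (by norm_num)]
    linarith
  · intro h5
    have hp5 : (5 : ℝ) ≤ p := by exact_mod_cast h5
    have hsq2 : (2 : ℝ) ≤ Real.sqrt p := by
      rw [Real.le_sqrt (by norm_num) (by linarith)]; nlinarith
    rw [inv_le_comm₀ (by linarith) (by norm_num)]
    linarith

/-! ### Peeling one prime: `∑_{e ∣ p^n a} τ(qe)/√e` -/

/-- `√(p^j) = (√p)^j`. [folklore] -/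
theorem sqrt_natCast_pow (p : ℕ) (j : ℕ) : Real.sqrt ((p : ℝ) ^ j) = (Real.sqrt p) ^ j := by
  have hp : (0 : ℝ) ≤ p := Nat.cast_nonneg p
  rw [Real.sqrt_eq_rpow, Real.sqrt_eq_rpow, ← Real.rpow_natCast_mul hp, ← Real.rpow_mul_natCast hp,
    mul_comm]

/-- The divisors of `p^n a` (`p ∤ a`) are the `p^j d`, `j ≤ n`, `d ∣ a`, each once. [folklore] -/
theorem sum_divisors_prime_pow_mul {p a : ℕ} (hp : p.Prime) (hpa : ¬ p ∣ a) (n : ℕ) (F : ℕ → ℝ) :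
    ∑ e ∈ (p ^ n * a).divisors, F e = ∑ j ∈ range (n + 1), ∑ d ∈ a.divisors, F (p ^ j * d) := by
  have hcop : (p ^ n).Coprime a := Nat.Coprime.pow_left n (hp.coprime_iff_not_dvd.2 hpa)
  rw [Nat.divisors_mul, ← Finset.image_mul_product, Finset.sum_image hcop.mul_injOn_divisors,
    Finset.sum_product, Nat.divisors_prime_pow hp, Finset.sum_map]
  rfl

/-- `τ(p^k b) = (k + 1) τ(b)` for `p ∤ b` (with the tree's `τ(p^k) = k + 1`,
`LFunctions.card_divisors_prime_pow`). [folklore] -/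
theorem card_divisors_prime_pow_mul {p b : ℕ} (hp : p.Prime) (hpb : ¬ p ∣ b) (k : ℕ) :
    (p ^ k * b).divisors.card = (k + 1) * b.divisors.card := by
  have hcop : (p ^ k).Coprime b := Nat.Coprime.pow_left k (hp.coprime_iff_not_dvd.2 hpb)
  rw [Nat.Coprime.card_divisors_mul hcop, LFunctions.card_divisors_prime_pow hp]

/-- **Peeling one prime.**  For `p ∤ a` and `q = p^α q'` with `p ∤ q'`:
`∑_{e ∣ p^n a} τ(qe)/√e = (∑_{j ≤ n} (α + j + 1) p^{-j/2}) · ∑_{d ∣ a} τ(q'd)/√d`. [folklore] -/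
theorem sum_divisors_tau_mul_div_sqrt_peel {p a q' : ℕ} (hp : p.Prime) (hpa : ¬ p ∣ a)
    (hpq : ¬ p ∣ q') (α n : ℕ) :
    ∑ e ∈ (p ^ n * a).divisors, (((p ^ α * q') * e).divisors.card : ℝ) / Real.sqrt e =
      (∑ j ∈ range (n + 1), ((α : ℝ) + j + 1) * ((Real.sqrt p)⁻¹) ^ j) *
        ∑ d ∈ a.divisors, ((q' * d).divisors.card : ℝ) / Real.sqrt d := by
  rw [sum_divisors_prime_pow_mul hp hpa, Finset.sum_mul_sum]
  refine Finset.sum_congr rfl fun j _ => Finset.sum_congr rfl fun d hd => ?_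
  have hd0 : d ≠ 0 := Nat.ne_of_gt (Nat.pos_of_mem_divisors hd)
  have hpd : ¬ p ∣ q' * d := by
    intro h
    rcases hp.dvd_mul.1 h with h | h
    · exact hpq h
    · exact hpa (dvd_trans h (Nat.dvd_of_mem_divisors hd))
  have e1 : p ^ α * q' * (p ^ j * d) = p ^ (α + j) * (q' * d) := by ring
  rw [e1, card_divisors_prime_pow_mul hp hpd]
  push_cast
  rw [Real.sqrt_mul (pow_nonneg (Nat.cast_nonneg p) j) (d : ℝ), sqrt_natCast_pow, inv_pow]
  have hsp : (0 : ℝ) < (Real.sqrt p) ^ j := pow_pos (Real.sqrt_pos.2 (by exact_mod_cast hp.pos)) j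
  have hsd : (0 : ℝ) < Real.sqrt d := Real.sqrt_pos.2 (by exact_mod_cast Nat.pos_of_ne_zero hd0)
  field_simp

/-! ### The divisor sum `∑_{e ∣ m} τ(qe)/√e` -/

/-- **The divisor sum, prime by prime.**  For `q, t ≥ 1` and `m` such that `p^{v_p(q)} ∣ t` for
every prime `p ∣ m`:  `∑_{e ∣ m} τ(qe)/√e ≤ 8^{#{p ∣ m : p < 5}} τ(q m t)`.  (Induction on the
prime factorisation of `m`: peeling `p^n ∥ m` costs the factor `∑_{j ≤ n}(α+j+1)p^{-j/2}` on the
left, `α = v_p(q)`, and gains `α + n + v_p(t) + 1 ≥ 2α + n + 1` on the right.) [folklore] -/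
theorem sum_divisors_tau_mul_div_sqrt_le_aux (m : ℕ) :
    ∀ q t : ℕ, q ≠ 0 → t ≠ 0 → (∀ p ∈ m.primeFactors, p ^ (q.factorization p) ∣ t) →
      ∑ e ∈ m.divisors, ((q * e).divisors.card : ℝ) / Real.sqrt e ≤
        (8 : ℝ) ^ (m.primeFactors.filter (· < 5)).card * ((q * m * t).divisors.card : ℝ) := by
  induction m using Nat.recOnPrimePow with
  | zero =>
    intro q t _ _ _
    simp
  | one =>
    intro q t hq ht _
    simp only [Nat.divisors_one, Finset.sum_singleton, mul_one, Nat.cast_one, Real.sqrt_one,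
      div_one, Nat.primeFactors_one, Finset.filter_empty, Finset.card_empty, pow_zero, one_mul]
    exact_mod_cast Finset.card_le_card
      (Nat.divisors_subset_of_dvd (mul_ne_zero hq ht) (dvd_mul_right q t))
  | prime_pow_mul a p n hp hpa hn ih =>
    intro q t hq ht H
    have ha0 : a ≠ 0 := by rintro rfl; exact hpa (dvd_zero p)
    -- `q = p^α q'`, `t = p^β t'`
    set α := q.factorization p with hα
    set q' := q / p ^ α with hq'
    have hqeq : q = p ^ α * q' := (Nat.ordProj_mul_ordCompl_eq_self q p).symm
    have hpq' : ¬ p ∣ q' := Nat.not_dvd_ordCompl hp hq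
    have hq'0 : q' ≠ 0 := by rintro h0; rw [h0, mul_zero] at hqeq; exact hq hqeq
    set β := t.factorization p with hβ
    set t' := t / p ^ β with ht'
    have hteq : t = p ^ β * t' := (Nat.ordProj_mul_ordCompl_eq_self t p).symm
    have hpt' : ¬ p ∣ t' := Nat.not_dvd_ordCompl hp ht
    have ht'0 : t' ≠ 0 := by rintro h0; rw [h0, mul_zero] at hteq; exact ht hteq
    -- `α ≤ β` from the hypothesis at `p`
    have hpmem : p ∈ (p ^ n * a).primeFactors := by
      rw [Nat.mem_primeFactors]
      exact ⟨hp, (dvd_pow_self p hn.ne').mul_right a, mul_ne_zero (pow_ne_zero _ hp.ne_zero) ha0⟩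
    have hαβ : α ≤ β := (hp.pow_dvd_iff_le_factorization ht).1 (H p hpmem)
    -- the induction hypothesis at `(q', t')`
    have H' : ∀ p'' ∈ a.primeFactors, p'' ^ (q'.factorization p'') ∣ t' := by
      intro p'' hp''
      have hp''P : p''.Prime := Nat.prime_of_mem_primeFactors hp''
      have hne : p'' ≠ p := by
        rintro rfl
        exact hpa (Nat.dvd_of_mem_primeFactors hp'')
      have hfac : q'.factorization p'' = q.factorization p'' := by
        rw [hq', hα, Nat.factorization_ordCompl, Finsupp.erase_ne hne]
      have h1 : p'' ^ (q.factorization p'') ∣ t := by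
        refine H p'' ?_
        rw [Nat.mem_primeFactors]
        exact ⟨hp''P, (Nat.dvd_of_mem_primeFactors hp'').mul_left _,
          mul_ne_zero (pow_ne_zero _ hp.ne_zero) ha0⟩
      rw [hfac]
      rw [hteq] at h1
      have hcop : (p'' ^ q.factorization p'').Coprime (p ^ β) :=
        Nat.Coprime.pow _ _ ((Nat.coprime_primes hp''P hp).2 hne)
      exact hcop.dvd_of_dvd_mul_left h1
    have IH := ih q' t' hq'0 ht'0 H'
    -- peel
    rw [hqeq, sum_divisors_tau_mul_div_sqrt_peel hp hpa hpq' α n]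
    -- the per-prime factor
    obtain ⟨hr34, hr12⟩ := inv_sqrt_le_of_prime hp
    have hr0 : 0 ≤ (Real.sqrt p)⁻¹ := inv_nonneg.2 (Real.sqrt_nonneg _)
    have hL : ∑ j ∈ range (n + 1), ((α : ℝ) + j + 1) * ((Real.sqrt p)⁻¹) ^ j ≤
        (if p < 5 then (8 : ℝ) else 1) * (2 * α + n + 1) := by
      split_ifs with h5
      · exact sum_range_linear_mul_pow_le_of_le_three_quarters hr0 hr34 α hn
      · rw [one_mul]
        exact sum_range_linear_mul_pow_le_of_le_half hr0 (hr12 (not_lt.1 h5)) α hn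
    have hL0 : 0 ≤ ∑ j ∈ range (n + 1), ((α : ℝ) + j + 1) * ((Real.sqrt p)⁻¹) ^ j :=
      Finset.sum_nonneg fun j _ => mul_nonneg (by positivity) (pow_nonneg hr0 j)
    have hB0 : 0 ≤ ∑ d ∈ a.divisors, ((q' * d).divisors.card : ℝ) / Real.sqrt d :=
      Finset.sum_nonneg fun d _ => div_nonneg (Nat.cast_nonneg _) (Real.sqrt_nonneg _)
    -- the prime factors of `p^n a`
    have hpf : (p ^ n * a).primeFactors = insert p a.primeFactors := by
      rw [Nat.primeFactors_mul (pow_ne_zero _ hp.ne_zero) ha0, Nat.primeFactors_prime_pow hn.ne' hp]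
      rfl
    have hpA : p ∉ a.primeFactors := fun h => hpa (Nat.dvd_of_mem_primeFactors h)
    have hcard : ((p ^ n * a).primeFactors.filter (· < 5)).card =
        (if p < 5 then 1 else 0) + (a.primeFactors.filter (· < 5)).card := by
      rw [hpf, Finset.filter_insert]
      split_ifs with h5
      · rw [Finset.card_insert_of_notMem (fun h => hpA (Finset.mem_filter.1 h).1), add_comm]
      · rw [zero_add]
    -- the right-hand side: `τ(q p^n a t) = (α + n + β + 1) τ(q' a t')`
    have hpqat : ¬ p ∣ q' * a * t' := by
      intro h
      rcases hp.dvd_mul.1 h with h | h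
      · rcases hp.dvd_mul.1 h with h | h
        · exact hpq' h
        · exact hpa h
      · exact hpt' h
    have hτ : ((p ^ α * q' * (p ^ n * a) * t).divisors.card : ℝ) =
        ((α : ℝ) + n + β + 1) * ((q' * a * t').divisors.card : ℝ) := by
      have e : p ^ α * q' * (p ^ n * a) * t = p ^ (α + n + β) * (q' * a * t') := by
        rw [hteq]; ring
      rw [e, card_divisors_prime_pow_mul hp hpqat]
      push_cast
      ring
    rw [hτ, hcard, pow_add]
    have hτ0 : (0 : ℝ) ≤ ((q' * a * t').divisors.card : ℝ) := Nat.cast_nonneg _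
    have h8 : (0 : ℝ) ≤ (8 : ℝ) ^ (a.primeFactors.filter (· < 5)).card := by positivity
    have hαr : (0 : ℝ) ≤ α := Nat.cast_nonneg α
    have hβr : (α : ℝ) ≤ β := by exact_mod_cast hαβ
    have hnr : (0 : ℝ) ≤ n := Nat.cast_nonneg n
    calc (∑ j ∈ range (n + 1), ((α : ℝ) + j + 1) * ((Real.sqrt p)⁻¹) ^ j) *
          ∑ d ∈ a.divisors, ((q' * d).divisors.card : ℝ) / Real.sqrt d
        ≤ ((if p < 5 then (8 : ℝ) else 1) * (2 * α + n + 1)) *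
          ((8 : ℝ) ^ (a.primeFactors.filter (· < 5)).card * ((q' * a * t').divisors.card : ℝ)) :=
          mul_le_mul hL IH hB0 (by split_ifs <;> positivity)
      _ ≤ (8 : ℝ) ^ (if p < 5 then 1 else 0) * (8 : ℝ) ^ (a.primeFactors.filter (· < 5)).card *
          (((α : ℝ) + n + β + 1) * ((q' * a * t').divisors.card : ℝ)) := by
          split_ifs with h5
          · simp only [pow_one]
            nlinarith [mul_nonneg h8 hτ0]
          · simp only [pow_zero, one_mul]
            nlinarith [mul_nonneg h8 hτ0]

/-! ### From `(q, h)` to `(q, h₁)`, `h₁ = h/(h,q)` -/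

/-- **`(h, qs) = (h,q)·(h₁, s)`** with `h₁ = h/(h,q)` (the part `q/(h,q)` of `q` is prime to `h₁`).
[folklore] -/
theorem gcd_mul_eq {h q : ℕ} (hh : h ≠ 0) (s : ℕ) :
    Nat.gcd h (q * s) = Nat.gcd h q * Nat.gcd (h / Nat.gcd h q) s := by
  set g := Nat.gcd h q with hg
  have hg0 : 0 < g := Nat.gcd_pos_of_pos_left q (Nat.pos_of_ne_zero hh)
  obtain ⟨h₁, hh₁⟩ : g ∣ h := Nat.gcd_dvd_left h q
  obtain ⟨q₁, hq₁⟩ : g ∣ q := Nat.gcd_dvd_right h q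
  have hcop : Nat.Coprime h₁ q₁ := by
    have := Nat.coprime_div_gcd_div_gcd hg0
    rw [← hg] at this
    conv at this => rw [hh₁, hq₁]; rw [Nat.mul_div_cancel_left _ hg0, Nat.mul_div_cancel_left _ hg0]
    exact this
  have hdiv : h / g = h₁ := by rw [hh₁, Nat.mul_div_cancel_left _ hg0]
  rw [hdiv]
  conv_lhs => rw [hh₁, hq₁, mul_assoc, Nat.gcd_mul_left]
  rw [Nat.Coprime.gcd_mul_left_cancel_right s hcop.symm]

/-- For a prime `p ∣ h₁ = h/(h,q)` one has `v_p((h,q)) = v_p(q)`, hence `p^{v_p(q)} ∣ (h,q)`.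
[folklore] -/
theorem ordProj_dvd_gcd_of_mem_primeFactors_div {h q : ℕ} (hh : h ≠ 0) (hq : q ≠ 0) {p : ℕ}
    (hp : p ∈ (h / Nat.gcd h q).primeFactors) : p ^ (q.factorization p) ∣ Nat.gcd h q := by
  set g := Nat.gcd h q with hg
  have hg0 : g ≠ 0 := (Nat.gcd_pos_of_pos_left q (Nat.pos_of_ne_zero hh)).ne'
  have hpP : p.Prime := Nat.prime_of_mem_primeFactors hp
  obtain ⟨h₁, hh₁⟩ : g ∣ h := Nat.gcd_dvd_left h q
  have hdiv : h / g = h₁ := by rw [hh₁, Nat.mul_div_cancel_left _ (Nat.pos_of_ne_zero hg0)]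
  rw [hdiv] at hp
  have hh₁0 : h₁ ≠ 0 := by rintro rfl; rw [mul_zero] at hh₁; exact hh hh₁
  have h1 : 1 ≤ h₁.factorization p := hpP.factorization_pos_of_dvd hh₁0 (Nat.dvd_of_mem_primeFactors hp)
  have h2 : h.factorization p = g.factorization p + h₁.factorization p := by
    rw [hh₁, Nat.factorization_mul hg0 hh₁0, Finsupp.add_apply]
  have h3 : g.factorization p = min (h.factorization p) (q.factorization p) := by
    rw [hg, Nat.factorization_gcd hh hq]; rfl
  have h4 : q.factorization p = g.factorization p := by omega
  rw [h4]
  exact Nat.ordProj_dvd g p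

/-- The primes below `5` dividing anything are among `2, 3`: `#{p ∣ m prime : p < 5} ≤ 2`.
[folklore] -/
theorem card_primeFactors_filter_lt_five_le (m : ℕ) : (m.primeFactors.filter (· < 5)).card ≤ 2 := by
  have hsub : m.primeFactors.filter (· < 5) ⊆ {2, 3} := by
    intro p hp
    rw [Finset.mem_filter] at hp
    have hpP : p.Prime := Nat.prime_of_mem_primeFactors hp.1
    have h2 := hpP.two_le
    have h5 := hp.2
    interval_cases p
    · simp
    · simp
    · exact absurd hpP (by decide)
  exact (Finset.card_le_card hsub).trans (by simp)

/-- **`∑_{e ∣ h₁} τ(qe)/√e ≤ 64 τ(hq)`**, `h₁ = h/(h,q)`, for `h, q ≥ 1`. [folklore] -/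
theorem sum_divisors_tau_mul_div_sqrt_le {h q : ℕ} (hh : h ≠ 0) (hq : q ≠ 0) :
    ∑ e ∈ (h / Nat.gcd h q).divisors, ((q * e).divisors.card : ℝ) / Real.sqrt e ≤
      64 * ((h * q).divisors.card : ℝ) := by
  set g := Nat.gcd h q with hg
  have hg0 : g ≠ 0 := (Nat.gcd_pos_of_pos_left q (Nat.pos_of_ne_zero hh)).ne'
  have key := sum_divisors_tau_mul_div_sqrt_le_aux (h / g) q g hq hg0
    (fun p hp => ordProj_dvd_gcd_of_mem_primeFactors_div hh hq hp)
  have hprod : q * (h / g) * g = h * q := by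
    rw [mul_assoc, Nat.div_mul_cancel (Nat.gcd_dvd_left h q), mul_comm]
  rw [hprod] at key
  refine key.trans (mul_le_mul_of_nonneg_right ?_ (Nat.cast_nonneg _))
  calc (8 : ℝ) ^ ((h / g).primeFactors.filter (· < 5)).card ≤ (8 : ℝ) ^ 2 :=
        pow_le_pow_right₀ (by norm_num) (card_primeFactors_filter_lt_five_le _)
    _ = 64 := by norm_num

/-! ### The sum over `s ≤ S` -/

/-- `τ(mn) ≤ τ(m) τ(n)`. [folklore] -/
theorem card_divisors_mul_le' (m n : ℕ) : (m * n).divisors.card ≤ m.divisors.card * n.divisors.card := by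
  rw [Nat.divisors_mul]; exact Finset.card_mul_le

/-- **Grouping by `e = (h₁, s)`**: for `h₁ ≥ 1`,
`∑_{s ≤ S} τ(qs) (h₁,s)^{1/2} s^{-1/2} ≤ ∑_{e ∣ h₁} ∑_{t ≤ S/e} τ(qet)/√t` (`s = et`). [folklore] -/
theorem sum_tau_sqrt_gcd_le_sum_divisors {h₁ : ℕ} (hh₁ : h₁ ≠ 0) (q S : ℕ) :
    ∑ s ∈ Icc 1 S, ((q * s).divisors.card : ℝ) * Real.sqrt (Nat.gcd h₁ s) / Real.sqrt s ≤
      ∑ e ∈ h₁.divisors, ∑ t ∈ Icc 1 (S / e), ((q * (e * t)).divisors.card : ℝ) / Real.sqrt t := by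
  classical
  rw [← Finset.sum_fiberwise_of_maps_to (s := Icc 1 S) (t := h₁.divisors) (g := fun s => Nat.gcd h₁ s)
    (fun s _ => Nat.mem_divisors.2 ⟨Nat.gcd_dvd_left _ _, hh₁⟩)]
  refine Finset.sum_le_sum fun e he => ?_
  have he0 : 0 < e := Nat.pos_of_mem_divisors he
  -- on the fibre `(h₁, s) = e`: `s = e (s/e)` and the term is `τ(q e (s/e))/√(s/e)`
  have hterm : ∀ s ∈ (Icc 1 S).filter (fun s => Nat.gcd h₁ s = e),
      ((q * s).divisors.card : ℝ) * Real.sqrt (Nat.gcd h₁ s) / Real.sqrt s =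
        ((q * (e * (s / e))).divisors.card : ℝ) / Real.sqrt ((s / e : ℕ) : ℝ) := by
    intro s hs
    rw [Finset.mem_filter] at hs
    obtain ⟨hs, hse⟩ := hs
    have hes : e ∣ s := hse ▸ Nat.gcd_dvd_right h₁ s
    have hs0 : 0 < s := (Finset.mem_Icc.1 hs).1
    have heq : e * (s / e) = s := Nat.mul_div_cancel' hes
    rw [hse, heq]
    have hcast : ((s / e : ℕ) : ℝ) = (s : ℝ) / e := by
      rw [Nat.cast_div hes (by exact_mod_cast he0.ne')]
    rw [hcast, Real.sqrt_div' _ (by exact_mod_cast he0.le)]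
    have hse' : 0 < Real.sqrt e := Real.sqrt_pos.2 (by exact_mod_cast he0)
    have hss' : 0 < Real.sqrt s := Real.sqrt_pos.2 (by exact_mod_cast hs0)
    field_simp
  rw [Finset.sum_congr rfl hterm]
  -- inject the fibre into `Icc 1 (S/e)` by `s ↦ s/e`
  have hinj : Set.InjOn (fun s : ℕ => s / e) ((Icc 1 S).filter (fun s => Nat.gcd h₁ s = e) : Finset ℕ) := by
    intro s hs s' hs' hss'
    simp only [Finset.coe_filter, Set.mem_setOf_eq] at hs hs'
    have hes : e ∣ s := hs.2 ▸ Nat.gcd_dvd_right h₁ s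
    have hes' : e ∣ s' := hs'.2 ▸ Nat.gcd_dvd_right h₁ s'
    have h1 := Nat.mul_div_cancel' hes
    have h2 := Nat.mul_div_cancel' hes'
    have hss'' : s / e = s' / e := hss'
    have : e * (s / e) = e * (s' / e) := by rw [hss'']
    rw [h1, h2] at this
    exact this
  have himage : ((Icc 1 S).filter (fun s => Nat.gcd h₁ s = e)).image (fun s => s / e) ⊆ Icc 1 (S / e) := by
    intro u hu
    rw [Finset.mem_image] at hu
    obtain ⟨s, hs, rfl⟩ := hu
    rw [Finset.mem_filter] at hs
    obtain ⟨hs, hse⟩ := hs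
    rw [Finset.mem_Icc] at hs ⊢
    have hes : e ∣ s := hse ▸ Nat.gcd_dvd_right h₁ s
    exact ⟨Nat.div_pos (Nat.le_of_dvd hs.1 hes) he0, Nat.div_le_div_right hs.2⟩
  calc ∑ s ∈ (Icc 1 S).filter (fun s => Nat.gcd h₁ s = e),
        ((q * (e * (s / e))).divisors.card : ℝ) / Real.sqrt ((s / e : ℕ) : ℝ)
      = ∑ u ∈ ((Icc 1 S).filter (fun s => Nat.gcd h₁ s = e)).image (fun s => s / e),
          ((q * (e * u)).divisors.card : ℝ) / Real.sqrt u := by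
        rw [Finset.sum_image hinj]
    _ ≤ ∑ t ∈ Icc 1 (S / e), ((q * (e * t)).divisors.card : ℝ) / Real.sqrt t :=
        Finset.sum_le_sum_of_subset_of_nonneg himage fun t _ _ =>
          div_nonneg (Nat.cast_nonneg _) (Real.sqrt_nonneg _)

/-- The inner sum: `∑_{t ≤ T} τ(qet)/√t ≤ 2 τ(qe) √T (1 + log T)` (`τ(qet) ≤ τ(qe)τ(t)` and the
tree's `∑_{t ≤ T} τ(t)/√t ≤ 2√T(1 + log T)`). [folklore] -/
theorem sum_tau_mul_div_sqrt_le (k T : ℕ) :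
    ∑ t ∈ Icc 1 T, ((k * t).divisors.card : ℝ) / Real.sqrt t ≤
      (k.divisors.card : ℝ) * (2 * Real.sqrt T * (1 + Real.log T)) := by
  calc ∑ t ∈ Icc 1 T, ((k * t).divisors.card : ℝ) / Real.sqrt t
      ≤ ∑ t ∈ Icc 1 T, (k.divisors.card : ℝ) * ((t.divisors.card : ℝ) / Real.sqrt t) := by
        refine Finset.sum_le_sum fun t _ => ?_
        rw [← mul_div_assoc]
        refine div_le_div_of_nonneg_right ?_ (Real.sqrt_nonneg _)
        exact_mod_cast card_divisors_mul_le' k t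
    _ = (k.divisors.card : ℝ) * ∑ t ∈ Icc 1 T, (t.divisors.card : ℝ) / Real.sqrt t := by
        rw [Finset.mul_sum]
    _ ≤ (k.divisors.card : ℝ) * (2 * Real.sqrt T * (1 + Real.log T)) :=
        mul_le_mul_of_nonneg_left (Hooley1963.sum_card_divisors_div_sqrt_le T) (Nat.cast_nonneg _)

/-- `√(S/e) (1 + log (S/e)) ≤ (√S/√e)(1 + log S)` for the integer quotient `S/e`, `e ≥ 1`. [folklore] -/
theorem sqrt_div_mul_log_le {S e : ℕ} (he : 0 < e) :
    Real.sqrt ((S / e : ℕ) : ℝ) * (1 + Real.log ((S / e : ℕ) : ℝ)) ≤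
      Real.sqrt S / Real.sqrt e * (1 + Real.log S) := by
  have hTle : ((S / e : ℕ) : ℝ) ≤ (S : ℝ) / e := Nat.cast_div_le
  have hTleS : ((S / e : ℕ) : ℝ) ≤ S := by exact_mod_cast Nat.div_le_self S e
  have hlogT0 : 0 ≤ 1 + Real.log ((S / e : ℕ) : ℝ) := by
    have : 0 ≤ Real.log ((S / e : ℕ) : ℝ) := Real.log_natCast_nonneg _
    linarith
  have hlogS0 : 0 ≤ Real.log (S : ℝ) := Real.log_natCast_nonneg _
  have hlog : Real.log ((S / e : ℕ) : ℝ) ≤ Real.log S := by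
    rcases Nat.eq_zero_or_pos (S / e) with h0 | hpos
    · rw [h0, Nat.cast_zero, Real.log_zero]; exact hlogS0
    · exact Real.log_le_log (by exact_mod_cast hpos) hTleS
  have hsqrt : Real.sqrt ((S / e : ℕ) : ℝ) ≤ Real.sqrt S / Real.sqrt e := by
    rw [← Real.sqrt_div' _ (by exact_mod_cast he.le)]
    exact Real.sqrt_le_sqrt hTle
  exact mul_le_mul hsqrt (by linarith) hlogT0 (by positivity)

/-- **The sum over `s ≤ S`**: for `h, q ≥ 1` and `h₁ = h/(h,q)`,
`∑_{s ≤ S} τ(qs) (h₁, s)^{1/2} s^{-1/2} ≤ 128 τ(hq) √S (1 + log S)`. [folklore] -/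
theorem sum_tau_sqrt_gcd_div_sqrt_le_aux {h q : ℕ} (hh : h ≠ 0) (hq : q ≠ 0) (S : ℕ) :
    ∑ s ∈ Icc 1 S, ((q * s).divisors.card : ℝ) * Real.sqrt (Nat.gcd (h / Nat.gcd h q) s) / Real.sqrt s ≤
      128 * ((h * q).divisors.card : ℝ) * Real.sqrt S * (1 + Real.log S) := by
  set h₁ := h / Nat.gcd h q with hh₁
  have hg0 : 0 < Nat.gcd h q := Nat.gcd_pos_of_pos_left q (Nat.pos_of_ne_zero hh)
  have hh₁0 : h₁ ≠ 0 := by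
    rw [hh₁]
    exact (Nat.div_pos (Nat.le_of_dvd (Nat.pos_of_ne_zero hh) (Nat.gcd_dvd_left h q)) hg0).ne'
  have hlogS0 : 0 ≤ Real.log (S : ℝ) := Real.log_natCast_nonneg _
  refine (sum_tau_sqrt_gcd_le_sum_divisors hh₁0 q S).trans ?_
  calc ∑ e ∈ h₁.divisors, ∑ t ∈ Icc 1 (S / e), ((q * (e * t)).divisors.card : ℝ) / Real.sqrt t
      ≤ ∑ e ∈ h₁.divisors, ((q * e).divisors.card : ℝ) / Real.sqrt e *
          (2 * Real.sqrt S * (1 + Real.log S)) := by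
        refine Finset.sum_le_sum fun e he => ?_
        have he0 : 0 < e := Nat.pos_of_mem_divisors he
        have h1 := sum_tau_mul_div_sqrt_le (q * e) (S / e)
        simp_rw [mul_assoc] at h1 ⊢
        refine h1.trans ?_
        have h2 := sqrt_div_mul_log_le (S := S) he0
        have hτ : (0 : ℝ) ≤ ((q * e).divisors.card : ℝ) := Nat.cast_nonneg _
        calc ((q * e).divisors.card : ℝ) * (2 * (Real.sqrt ((S / e : ℕ) : ℝ) *
              (1 + Real.log ((S / e : ℕ) : ℝ))))
            ≤ ((q * e).divisors.card : ℝ) * (2 * (Real.sqrt S / Real.sqrt e * (1 + Real.log S))) :=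
              mul_le_mul_of_nonneg_left (by linarith) hτ
          _ = ((q * e).divisors.card : ℝ) / Real.sqrt e * (2 * (Real.sqrt S * (1 + Real.log S))) := by
              ring
    _ = (∑ e ∈ h₁.divisors, ((q * e).divisors.card : ℝ) / Real.sqrt e) *
          (2 * Real.sqrt S * (1 + Real.log S)) := by rw [Finset.sum_mul]
    _ ≤ (64 * ((h * q).divisors.card : ℝ)) * (2 * Real.sqrt S * (1 + Real.log S)) :=
        mul_le_mul_of_nonneg_right (sum_divisors_tau_mul_div_sqrt_le hh hq) (by positivity)
    _ = 128 * ((h * q).divisors.card : ℝ) * Real.sqrt S * (1 + Real.log S) := by ring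

/-! ### The sum over `c ≡ 0 (mod q)`, `c ≤ X` -/

/-- **The arithmetic factor of DFI's Proposition 3 / (23).**  For `h, q ≥ 1` and `X ≥ 1`,
`∑_{1 ≤ c ≤ X, q ∣ c} τ(c) (h,c)^{1/2} c^{-1/2} ≤ 128 (h,q)^{1/2} τ(hq) q⁻¹ X^{1/2} (1 + log X)`;
with Weil's bound `|S(h,h;c)| ≤ τ(c) (h,c)^{1/2} c^{1/2}` this is the bound for
`∑_{c ≡ 0 (q), c ≤ X} |S(h,h;c)|/c`. [cite: DukeFriedlanderIwaniec1995, (23) p. 431] -/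
theorem sum_tau_sqrt_gcd_div_sqrt_le {h q : ℕ} (hh : h ≠ 0) (hq : q ≠ 0) {X : ℝ} (hX : 1 ≤ X) :
    ∑ c ∈ (Icc 1 ⌊X⌋₊).filter (fun c => q ∣ c),
        (c.divisors.card : ℝ) * Real.sqrt (Nat.gcd h c) / Real.sqrt c ≤
      128 * Real.sqrt (Nat.gcd h q) * ((h * q).divisors.card : ℝ) / q * Real.sqrt X *
        (1 + Real.log X) := by
  classical
  set N := ⌊X⌋₊ with hN
  set g := Nat.gcd h q with hg
  have hq0 : 0 < q := Nat.pos_of_ne_zero hq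
  have hg0 : 0 < g := Nat.gcd_pos_of_pos_left q (Nat.pos_of_ne_zero hh)
  have hX0 : 0 < X := by linarith
  have hlogX : 0 ≤ Real.log X := Real.log_nonneg hX
  -- `c = q s`, `s ≤ N/q`
  have hset : (Icc 1 N).filter (fun c => q ∣ c) = (Icc 1 (N / q)).image (fun s => q * s) := by
    ext c
    simp only [Finset.mem_filter, Finset.mem_Icc, Finset.mem_image]
    constructor
    · rintro ⟨⟨hc1, hcN⟩, ⟨s, rfl⟩⟩
      refine ⟨s, ⟨?_, ?_⟩, rfl⟩
      · rcases Nat.eq_zero_or_pos s with h0 | hpos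
        · subst h0; simp at hc1
        · exact hpos
      · exact (Nat.le_div_iff_mul_le hq0).2 (by rw [mul_comm]; exact hcN)
    · rintro ⟨s, ⟨hs1, hsN⟩, rfl⟩
      refine ⟨⟨Nat.mul_pos hq0 hs1, ?_⟩, dvd_mul_right q s⟩
      have := (Nat.le_div_iff_mul_le hq0).1 hsN
      rw [mul_comm]; exact this
  rw [hset, Finset.sum_image fun s _ s' _ hss' => Nat.eq_of_mul_eq_mul_left hq0 hss']
  -- the terms: `τ(qs) √((h,q)(h₁,s)) / √(qs) = (√g/√q) · τ(qs) √((h₁,s))/√s`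
  have hterm : ∀ s ∈ Icc 1 (N / q),
      (((q * s).divisors.card : ℝ) * Real.sqrt (Nat.gcd h (q * s)) / Real.sqrt ((q * s : ℕ) : ℝ)) =
        Real.sqrt g / Real.sqrt q *
          (((q * s).divisors.card : ℝ) * Real.sqrt (Nat.gcd (h / g) s) / Real.sqrt s) := by
    intro s hs
    have hs0 : 0 < s := (Finset.mem_Icc.1 hs).1
    rw [gcd_mul_eq hh s, ← hg]
    push_cast
    rw [Real.sqrt_mul (Nat.cast_nonneg _), Real.sqrt_mul (Nat.cast_nonneg _)]
    have h1 : 0 < Real.sqrt q := Real.sqrt_pos.2 (by exact_mod_cast hq0)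
    have h2 : 0 < Real.sqrt s := Real.sqrt_pos.2 (by exact_mod_cast hs0)
    field_simp
  rw [Finset.sum_congr rfl hterm, ← Finset.mul_sum]
  have hA := sum_tau_sqrt_gcd_div_sqrt_le_aux hh hq (N / q)
  rw [← hg] at hA
  -- `N/q ≤ X/q`
  have hNX : (N : ℝ) ≤ X := Nat.floor_le hX0.le
  have hSle : ((N / q : ℕ) : ℝ) ≤ X / q :=
    (Nat.cast_div_le).trans (div_le_div_of_nonneg_right hNX (by exact_mod_cast hq0.le))
  have hSleX : ((N / q : ℕ) : ℝ) ≤ X := by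
    refine le_trans ?_ hNX
    exact_mod_cast Nat.div_le_self N q
  have hlogS : Real.log ((N / q : ℕ) : ℝ) ≤ Real.log X := by
    rcases Nat.eq_zero_or_pos (N / q) with h0 | hpos
    · rw [h0, Nat.cast_zero, Real.log_zero]; exact hlogX
    · exact Real.log_le_log (by exact_mod_cast hpos) hSleX
  have hlogS0 : 0 ≤ 1 + Real.log ((N / q : ℕ) : ℝ) := by
    have := Real.log_natCast_nonneg (N / q); linarith
  have hsqrtS : Real.sqrt ((N / q : ℕ) : ℝ) ≤ Real.sqrt X / Real.sqrt q := by
    rw [← Real.sqrt_div' _ (by exact_mod_cast hq0.le)]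
    exact Real.sqrt_le_sqrt hSle
  have hτ0 : (0 : ℝ) ≤ 128 * ((h * q).divisors.card : ℝ) := by positivity
  have hB : 128 * ((h * q).divisors.card : ℝ) * Real.sqrt ((N / q : ℕ) : ℝ) *
      (1 + Real.log ((N / q : ℕ) : ℝ)) ≤
      128 * ((h * q).divisors.card : ℝ) * (Real.sqrt X / Real.sqrt q) * (1 + Real.log X) := by
    have := mul_le_mul hsqrtS (show 1 + Real.log ((N / q : ℕ) : ℝ) ≤ 1 + Real.log X by linarith)
      hlogS0 (by positivity)
    calc 128 * ((h * q).divisors.card : ℝ) * Real.sqrt ((N / q : ℕ) : ℝ) *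
          (1 + Real.log ((N / q : ℕ) : ℝ))
        = 128 * ((h * q).divisors.card : ℝ) * (Real.sqrt ((N / q : ℕ) : ℝ) *
          (1 + Real.log ((N / q : ℕ) : ℝ))) := by ring
      _ ≤ 128 * ((h * q).divisors.card : ℝ) * (Real.sqrt X / Real.sqrt q * (1 + Real.log X)) :=
          mul_le_mul_of_nonneg_left this hτ0
      _ = _ := by ring
  have hsq : Real.sqrt q * Real.sqrt q = q := Real.mul_self_sqrt (by exact_mod_cast hq0.le)
  have hsq0 : 0 < Real.sqrt q := Real.sqrt_pos.2 (by exact_mod_cast hq0)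
  calc Real.sqrt g / Real.sqrt q *
        ∑ s ∈ Icc 1 (N / q), ((q * s).divisors.card : ℝ) * Real.sqrt (Nat.gcd (h / g) s) / Real.sqrt s
      ≤ Real.sqrt g / Real.sqrt q * (128 * ((h * q).divisors.card : ℝ) *
          (Real.sqrt X / Real.sqrt q) * (1 + Real.log X)) :=
        mul_le_mul_of_nonneg_left (hA.trans hB) (by positivity)
    _ = 128 * Real.sqrt g * ((h * q).divisors.card : ℝ) / q * Real.sqrt X * (1 + Real.log X) := by
        conv_rhs => rw [← hsq]
        field_simp

end DFI1995

end Literature.NumberTheory.Sieve
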